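import Summits.QuantumFields.GaugeBoot.DiagonalRPTorusInnerHalfNegativeThreeAll
import HarnessLib

/-!
# Inner-half diagonal RP fails on every even three-torus `L ≥ 4` for sign-character groups, `ℤ₂`
included (gauge-boot, task L3 sequel `d = 3`, `L = 4`; corollary file)

HONEST FRAMING (cell `pub-gaugeboot`, page 1 of every file): the venture produces certified bounds
on lattice expectations at stated coupling, gauge group, dimension and torus size; NOT a mass gap,
NOT a continuum limit, NOT a string tension; NOT Yang–Mills-summit-bearing (barriers
`FixedCouplingUltralocality`, `PerturbativeInvisibility`). This module is a structural NEGATIVE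
result about which positivity constraints a TORUS certificate may use; it discharges nothing else.

## Content

`DiagRPThree.not_innerDiagonalRP_even` (L3(ν)) refutes inner-half diagonal RP on the even
three-tori `L ≥ 6` for every compact group with a `{±1}`-valued character attaining `-1`, with a
window `0 < β ≤ 1/5000` uniform in `L`; `L = 4` was left open there (line-cut bounds). The moment
form of this sequel, `DiagRPRest.not_innerDiagonalRP_even_three_of_moments` (half-action trick,
every even `L ≥ 4`), applies to sign characters as well: the character identities hold with
`c₁ = c₂ = 1` (`sign_R1`, `sign_R2`: `σ` is real, multiplicative, `σ(g⁻¹) = σ(g)`), and an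
element of sign `-1` is a centre element `ρ z₀ = (-1) • 1`.

* **`not_innerDiagonalRP_even_three_sign`** — every compact metrisable `G`, continuous
  `ρ : G →* Matrix (Fin 1) (Fin 1) ℂ` with values in `{1, -1}` attaining `-1`, every even `L ≥ 4`:
  `∃ β₀ > 0, ∀ 0 < β ≤ β₀, ¬ InnerDiagonalRP (d := 3) (L := L) ρ β 0 1` (`β₀ = β₀(L)`, existential —
  weaker than L3(ν)'s uniform window where both apply, but covering `L = 4`);
* **`not_innerDiagonalRP_even_three_intUnits`** — the `ℤ₂` instance (`signRepIntUnits`), in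
  particular on `(ℤ/4)³`.

Elementary; no named fact.
-/

open MeasureTheory Finset Function
open scoped ComplexOrder

namespace Summit.QuantumFields.GaugeBoot

open Literature.MathematicalPhysics.QuantumFieldTheory
open Literature.MathematicalPhysics.QuantumFieldTheory.PlaquetteLowerBound (reTr)

noncomputable section

namespace DiagRPRest

open DiagRPThree

/-! ## The character identities of a sign character -/

section Sign

variable {G : Type*} [Group G] [TopologicalSpace G] [IsTopologicalGroup G] [CompactSpace G]
  [MeasurableSpace G] [BorelSpace G] (ρ : G →* Matrix (Fin 1) (Fin 1) ℂ)

omit [TopologicalSpace G] [IsTopologicalGroup G] [CompactSpace G] [MeasurableSpace G]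
  [BorelSpace G] in
/-- `Re tr ρ(g) = σ(g)`. -/
theorem reTr_eq_sgn (g : G) : reTr ρ g = sgn ρ g := trace_re_eq_sgn g

omit [TopologicalSpace G] [IsTopologicalGroup G] [CompactSpace G] [MeasurableSpace G]
  [BorelSpace G] in
/-- `σ(g)² = 1`. -/
theorem sgn_mul_self (hval : ∀ g, ρ g = 1 ∨ ρ g = -1) (g : G) : sgn ρ g * sgn ρ g = 1 := by
  rcases sgn_cases hval g with h | h <;> rw [h] <;> norm_num

/-- **(R1) for a sign character**, `c₁ = 1`: `∫ σ(x g⁻¹) σ(g y) dg = σ(x y)`. -/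
theorem sign_R1 (hval : ∀ g, ρ g = 1 ∨ ρ g = -1) (x y : G) :
    ∫ g, reTr ρ (x * g⁻¹) * reTr ρ (g * y) ∂haarProbability G = 1 * reTr ρ (x * y) := by
  have h : ∀ g : G, reTr ρ (x * g⁻¹) * reTr ρ (g * y) = reTr ρ (x * y) := fun g => by
    simp only [reTr_eq_sgn, sgn_mul hval, sgn_inv hval]
    linear_combination (sgn ρ x * sgn ρ y) * sgn_mul_self ρ hval g
  simp_rw [h, integral_const, probReal_univ, one_smul, one_mul]

/-- **(R2) for a sign character**, `c₂ = 1`: `∫ σ(g x g⁻¹ y) dg = σ(x) σ(y) = Re(tr ρ(x) tr ρ(y))`. -/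
theorem sign_R2 (hval : ∀ g, ρ g = 1 ∨ ρ g = -1) (x y : G) :
    ∫ g, reTr ρ (g * x * g⁻¹ * y) ∂haarProbability G = 1 * ((ρ x).trace * (ρ y).trace).re := by
  have htr : ∀ g : G, (ρ g).trace = (sgn ρ g : ℂ) := fun g => by
    rw [Matrix.trace_fin_one, sgn]
    rcases entry_cases hval g with h | h <;> simp [h]
  have h : ∀ g : G, reTr ρ (g * x * g⁻¹ * y) = sgn ρ x * sgn ρ y := fun g => by
    simp only [reTr_eq_sgn, sgn_mul hval, sgn_inv hval]
    linear_combination (sgn ρ x * sgn ρ y) * sgn_mul_self ρ hval g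
  simp_rw [h, integral_const, probReal_univ, one_smul, one_mul, htr]
  norm_cast

end Sign

/-! ## The negatives -/

section Negative

variable {L : ℕ} [NeZero L] {G : Type*} [Group G] [TopologicalSpace G] [IsTopologicalGroup G]
  [CompactSpace G] [MeasurableSpace G] [BorelSpace G] [SecondCountableTopology G]
  (ρ : G →* Matrix (Fin 1) (Fin 1) ℂ)

/-- ★ **Inner-half diagonal RP fails on every even three-torus `L ≥ 4` for a sign character.**
For every compact metrisable `G`, continuous `ρ : G →* Matrix (Fin 1) (Fin 1) ℂ` with values in
`{1, -1}` attaining `-1`, and every even `L ≥ 4`, there is `β₀ > 0` with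
`¬ InnerDiagonalRP (d := 3) (L := L) ρ β 0 1` for all `0 < β ≤ β₀`. -/
theorem not_innerDiagonalRP_even_three_sign (hρ : Continuous ρ) (hval : ∀ g, ρ g = 1 ∨ ρ g = -1)
    (hne : ∃ g, ρ g = -1) (hLeven : Even L) (h4 : 4 ≤ L) :
    ∃ β₀ : ℝ, 0 < β₀ ∧ ∀ β : ℝ, 0 < β → β ≤ β₀ →
      ¬ InnerDiagonalRP (d := 3) (L := L) ρ β 0 1 := by
  obtain ⟨z₀, hz₀⟩ := hne
  have hz : ρ z₀ = (-1 : ℂ) • (1 : Matrix (Fin 1) (Fin 1) ℂ) := by rw [hz₀, neg_one_smul]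
  exact not_innerDiagonalRP_even_three_of_moments ρ hLeven h4 hρ le_rfl hz (by norm_num) one_pos
    one_pos (sign_R1 ρ hval) (sign_R2 ρ hval)

end Negative

/-- ★ **`ℤ₂` lattice gauge theory violates inner-half diagonal RP on every even three-torus
`(ℤ/L)³`, `L ≥ 4` — so on `(ℤ/4)³` — for all sufficiently small `β > 0`** (`G = ℤˣ`,
`ρ = signRepIntUnits`; not vacuous). -/
theorem not_innerDiagonalRP_even_three_intUnits {L : ℕ} [NeZero L] (hLeven : Even L) (h4 : 4 ≤ L) :
    ∃ β₀ : ℝ, 0 < β₀ ∧ ∀ β : ℝ, 0 < β → β ≤ β₀ →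
      ¬ InnerDiagonalRP (d := 3) (L := L) signRepIntUnits β 0 1 :=
  not_innerDiagonalRP_even_three_sign signRepIntUnits continuous_of_discreteTopology
    signRepIntUnits_eq_one_or ⟨-1, signRepIntUnits_neg_one⟩ hLeven h4

end DiagRPRest

end

end Summit.QuantumFields.GaugeBoot
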